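import Summits.BirchSwinnertonDyer.BirchSwinnertonDyer.Theorems.Rank1ResidualJetThm63LocalInputs
import Summits.BirchSwinnertonDyer.BirchSwinnertonDyer.Theorems.Rank1ResidualJetLocalIndex
import HarnessLib

/-!
# T1 JET (cell `bsd-jet`), road K: the H63 line with the STRINGENT FAMILY `JET.stringentFamily`
# plugged in — (δ) discharged: `hS`, `hidx`, `hcyc` ⟸ minimality at the carrier place, `c_{v₀} ≠ 0`,
# cyclic component group

HONEST FRAMING (programme file §HONESTY, verbatim): «no tranche here proves BSD; ARM L moves the
LITERAL column of an r ≤ 1 census into the kernel-proved-modulo-named-print column.» THEOREMS ONLY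
(seat `bsd-jet-pv-2`, session g4; `--supports stmt-BirchSwinnertonDyer-14418`, helper); 0 classes
move. WHAT THIS IS. `JET.tamagawaExponent_le_mInfty_of_localInputs` (p508802) keeps the stringent
family `𝒮` abstract with three hypotheses: `hS` (`𝒮 ≤ Kum`), `hidx` (`[Kum_{v₀} : 𝒮_{v₀}] = p^t`) and
`hcyc` (`Kum_{v₀}/𝒮_{v₀}` cyclic) — Jetchev's (δ) (p. 822) / Lemma 3.2 (p. 814). Here `𝒮 :=
JET.stringentFamily` (the connected Kummer condition `δ(E₀(K_v))` at the minimal places, p492589) and: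
* `hS` := `stringentFamily_le_kummer`;
* `hidx` := `relIndex_stringentFamily_eq_pow` (p503010): `t = ord_p c_{v₀}` for `k ≥ ord_p c_{v₀}`;
* `hcyc` := `isAddCyclic_kummer_quotient_stringentFamily` (this file): `Kum_{v₀}/𝒮_{v₀}` is the image
  of `E(K_{v₀})/(E₀ + p^k E(K_{v₀}))` under the local Kummer map (exactness `range δ = Kum`,
  `ker δ = p^k E`, tree `range_localKummerMap`/`ker_localKummerMap`), hence cyclic as soon as the
  component group `E(K_{v₀})/E₀(K_{v₀})` is (`hΦ`; for split multiplicative reduction a tree theorem,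
  `isAddCyclic_quotient_goodReductionSubgroup_of_hasSplitMultiplicativeReduction`; `ℤ/3` at `IV`, `IV*`).
So the (δ) inputs are reduced to three facts about ONE completion `K_{v₀}`: the base change of the
globally minimal `W` is minimal over `𝓞_{K_{v₀}}` (instance binder), `c_{v₀} ≠ 0`, `Φ_{v₀}` cyclic; and
`t` is now `ord_p c_{v₀}(E/K)`. Everything else is as in p508802 (named print `h44`/`h53`/`hGZ`/`hPT`,
Weil datum, local inputs `htr`, `h49str`, `h49tr`, `h𝒯σ`, `h𝒯sd`, `h𝒮σ`, `hloc`).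
References: [cite: Jetchev2008, Lemma 3.2 (p. 814), proof of Thm. 5.2 (p. 822, (δ)), §3.1 (p. 814)]
[cite: SilvermanAEC2009, VII.6 (c_v), X.§4 (**)].
-/

set_option autoImplicit false

noncomputable section

open scoped Classical Pointwise

open WeierstrassCurve IsDedekindDomain NumberField Field Literature.NumberTheory.EllipticCurves
  Literature.NumberTheory.EllipticCurves.ModularForms Literature.NumberTheory.EllipticCurves.Jetchev2008
  Literature.NumberTheory.GaloisRepresentations Literature.NumberTheory.GaloisCohomology
  Literature.NumberTheory.GaloisRepresentations.DiscreteGaloisModule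
  Summit.BirchSwinnertonDyer.Rank1Residual.X11b Summit.BirchSwinnertonDyer.Rank1Residual.X11b.Three
  Summit.BirchSwinnertonDyer.Rank1Residual.JET.SelmerVocabulary Literature.NumberTheory.Automorphic

namespace Summit.BirchSwinnertonDyer.Rank1Residual.JET

/-! ## §1 Cyclicity transfer along the local Kummer map -/

section Transfer

variable {P H : Type*} [AddCommGroup P] [AddCommGroup H]

/-- **A quotient `δ(P)/δ(U)` is cyclic if `P/U` is**: for `δ : P → H` and `U ≤ P`, the group
`range δ / (δ(U) ∩ range δ)` is the image of `P/U`. [folklore] -/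
theorem isAddCyclic_range_quotient_map (δ : P →+ H) (U : AddSubgroup P) [hU : IsAddCyclic (P ⧸ U)]
    {A B : AddSubgroup H} (hA : A = δ.range) (hB : B = U.map δ) :
    IsAddCyclic (A ⧸ B.addSubgroupOf A) := by
  subst hA hB
  let f : P →+ δ.range ⧸ (U.map δ).addSubgroupOf δ.range :=
    (QuotientAddGroup.mk' _).comp δ.rangeRestrict
  have hf : Function.Surjective f :=
    (QuotientAddGroup.mk'_surjective _).comp δ.rangeRestrict_surjective
  have hUf : U ≤ f.ker := fun u hu ↦ by
    rw [AddMonoidHom.mem_ker]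
    change QuotientAddGroup.mk' _ (δ.rangeRestrict u) = 0
    rw [QuotientAddGroup.mk'_apply, QuotientAddGroup.eq_zero_iff, AddSubgroup.mem_addSubgroupOf,
      AddMonoidHom.coe_rangeRestrict]
    exact AddSubgroup.mem_map_of_mem δ hu
  have hg : Function.Surjective (QuotientAddGroup.lift U f hUf) := by
    intro y
    obtain ⟨x, rfl⟩ := hf y
    exact ⟨QuotientAddGroup.mk x, rfl⟩
  exact isAddCyclic_of_surjective _ hg

end Transfer

/-! ## §2 (δ) for the road-K stringent family: cyclicity of `Kum_{v₀}/𝒮_{v₀}` -/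

section Delta

variable (W : WeierstrassCurve ℚ) [W.IsElliptic] (K : Type) [Field K] [NumberField K]

/-- **(δ), cyclicity half, for `JET.stringentFamily`** at a finite place `q` where the base change of
`W` is minimal over `𝓞_{K_q}`: `H¹_Kum(K_q, E[n]) / 𝒮_q` is cyclic whenever the component group
`E(K_q)/E₀(K_q)` is — it is the image of `E(K_q)/E₀(K_q)` under the local Kummer map `δ`
(`Kum = range δ`, `𝒮_q = δ(E₀)`). [cite: Jetchev2008, Lemma 3.2 (p. 814), (δ) (p. 822)]
[cite: SilvermanAEC2009, X.§4 (**)] -/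
theorem isAddCyclic_kummer_quotient_stringentFamily {n : ℤ} (hn : n ≠ 0) (q : HeightOneSpectrum (𝓞 K))
    [hmin : ((W.baseChange K).baseChange (q.adicCompletion K)).IsMinimal (q.adicCompletionIntegers K)]
    [hΦ : IsAddCyclic (((W.baseChange K).baseChange (q.adicCompletion K)).toAffine.Point ⧸
      ((W.baseChange K).baseChange (q.adicCompletion K)).goodReductionSubgroup (q.adicCompletionIntegers K))] :
    IsAddCyclic (↥((W.baseChange K).kummerSelmerStructure n (Sum.inr q)) ⧸
      (stringentFamily W K hn (Sum.inr q)).addSubgroupOf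
        ((W.baseChange K).kummerSelmerStructure n (Sum.inr q))) := by
  haveI : CharZero (q.adicCompletion K) :=
    charZero_of_injective_algebraMap (algebraMap K _).injective
  refine isAddCyclic_range_quotient_map ((W.baseChange K).localKummerMap (q.adicCompletion K) hn)
    (((W.baseChange K).baseChange (q.adicCompletion K)).goodReductionSubgroup (q.adicCompletionIntegers K))
    ?_ ?_
  · rw [WeierstrassCurve.kummerSelmerStructure_apply]
    exact ((W.baseChange K).range_localKummerMap (q.adicCompletion K) hn).symm
  · rw [stringentFamily_inr_of_isMinimal W K hn q]
    rfl

end Delta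

/-! ## §3 The H63 line with `𝒮 := JET.stringentFamily` -/

/-- **[J] Thm 5.2 at a core vertex, reduced to local inputs, stringent family plugged in** —
`tamagawaExponent_le_mInfty_of_localInputs` with `𝒮 := JET.stringentFamily`, `hS`, `hidx`, `hcyc`
DISCHARGED (`stringentFamily_le_kummer`, `relIndex_stringentFamily_eq_pow`,
`isAddCyclic_kummer_quotient_stringentFamily`) from: minimality of the base change at the carrier place
`v₀` (instance binder), `c_{v₀} ≠ 0`, the component group at `v₀` cyclic (instance binder). The
exponent is `t = ord_p c_{v₀}(E/K)`. CONCLUSION: `ord_p c_{v₀} ≤ m_∞`. Remaining hypotheses as in the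
parent (named print `h44`/`h53`/`hGZ`/`hPT`, the `τ`-equivariant Weil datum, local inputs `htr`,
`h49str`, `h49tr`, `h𝒯σ`, `h𝒯sd`, `h𝒮σ`, `hloc`). [cite: Jetchev2008, Thm. 5.2 (p. 821), Lemma 3.2
(p. 814), (δ) (p. 822)] [cite: McCallumLMS1991, §4 Prop. 4.4] [cite: GrossLMS1991, Prop. 5.3, Prop. 6.2 (1)]
[cite: GrossZagier1986, III (3.1)] [cite: MilneADT2006, Ch. I, Thm. 4.10(b)] -/
theorem tamagawaExponent_le_mInfty_of_localInputs_stringent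
    (h44 : McCallum1991.prop44_localOrder_kolyvaginClass_mul_eq)
    (W : WeierstrassCurve ℚ) [W.IsElliptic] [W.IsGloballyMinimal] [NeZero (W.conductorNorm ℤ)]
    (hcm : ¬ W.HasCM) (K : Type) [Field K] [NumberField K] (hK : IsImaginaryQuadratic K)
    (hD3 : NumberField.discr K ≠ -3) (hD4 : NumberField.discr K ≠ -4)
    (hH : SatisfiesHeegnerHypothesis (W.conductorNorm ℤ) K)
    (hPT : poitouTate_selmerStructure_duality_conj K)
    (p : ℕ) [Fact p.Prime] (hp2 : p ≠ 2) (htower : ∀ n : ℕ, W.HasSurjectiveModNGaloisRep (p ^ n : ℕ))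
    (Dt : ModularParametrizationData W (W.conductorNorm ℤ)) (β : ℤ) (ι : K →+* ℂ)
    [∀ j : ℕ, NumberField (ringClassField K ι j)]
    (τ : K ≃ₐ[ℚ] K) (hτ : τ ≠ 1) (hτ2 : τ * τ = 1)
    (ε : ℤ) (hε : ε = 1 ∨ ε = -1)
    (h53 : ∀ (m : ℕ) (dm : KolyvaginHeegnerData Dt β ι m)
      (τm : ringClassField K ι m ≃ₐ[ℚ] ringClassField K ι m),
      (∀ x : ringClassField K ι m, ((τm x : ringClassField K ι m) : ℂ) = starRingEnd ℂ x) →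
      ∃ σ' ∈ ringClassGal ι m, IsOfFinAddOrder
        (pointGalHom W (ringClassField K ι m) τm dm.y -
          ε • pointGalHom W (ringClassField K ι m) σ' dm.y))
    {n' : ℤ} (hcop' : IsCoprime (p : ℤ) n')
    (hGZ : ∀ (m : ℕ) (dm : KolyvaginHeegnerData Dt β ι m)
      (γ : ringClassField K ι m ≃ₐ[ℚ] ringClassField K ι m), γ ∈ ringClassGal ι m →
      ∀ v : HeightOneSpectrum (𝓞 K), ¬ (W.baseChange K).HasGoodReductionAt v →
        n' • pointsMap (W.baseChange K) (v.adicCompletion K)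
            (dm.toGeomPoints (pointGalHom W (ringClassField K ι m) γ dm.y)) ∈
          E0Receptacle (W.baseChange K) v ∧
        ∀ (ℓ : ℕ), ℓ ∈ m.primeFactors → ∀ (dm' : KolyvaginHeegnerData Dt β ι (m / ℓ))
          (hle : ringClassField K ι (m / ℓ) ≤ ringClassField K ι m),
          n' • pointsMap (W.baseChange K) (v.adicCompletion K)
              (dm.toGeomPoints (pointGalHom W (ringClassField K ι m) γ
                (WeierstrassCurve.Affine.Point.map (W' := W)
                  ((RingClassField.inclusion ι hle).restrictScalars ℚ) dm'.y))) ∈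
            E0Receptacle (W.baseChange K) v)
    (mdiv m : {c : ℕ // Squarefree c ∧ ∀ ℓ ∈ c.primeFactors,
        Zhang2014.IsKolyvaginPrime (W.conductorNorm ℤ) W K p ℓ} → ℕ∞)
    (hmdiv : ∀ c (u : ℕ), (u : ℕ∞) ≤ mdiv c ↔ ∀ d : KolyvaginHeegnerData Dt β ι c.1,
      ∃ Q : (W.baseChange (ringClassField K ι c.1)).toAffine.Point,
        ((p ^ u : ℕ) : ℤ) • Q = d.derivedPoint)
    (hm : ∀ c, m c = if mdiv c < Zhang2014.levelIndex W p c.1 then mdiv c else ⊤)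
    (k : ℕ) [NeZero (p ^ k)] [Finite (geomTorsion (W.baseChange K) ((p ^ k : ℕ) : ℤ))]
    (hn : ((p ^ k : ℕ) : ℤ) ≠ 0)
    (c : {c : ℕ // Squarefree c ∧ ∀ ℓ ∈ c.primeFactors,
        Zhang2014.IsKolyvaginPrime (W.conductorNorm ℤ) W K p ℓ}) (hk : 1 ≤ k)
    (hcore : IsGlobalCoreVertex W K ι τ p k c.1) (mInf : ℕ) (hmc : m c = mInf)
    (hkM : (k : ℕ∞) + mInf ≤ Zhang2014.levelIndex W p c.1) (hik : mInf < k)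
    -- the carrier: a place `v₀` over the conductor, split, with the (δ) data of `K_{v₀}`
    (v₀ : HeightOneSpectrum (𝓞 K)) (hv₀ : τ • v₀ ≠ v₀)
    (hv₀N : ((W.conductorNorm ℤ : ℕ) : 𝓞 K) ∈ v₀.asIdeal)
    [hmin : ((W.baseChange K).baseChange (v₀.adicCompletion K)).IsMinimal (v₀.adicCompletionIntegers K)]
    (hc0 : ((W.baseChange K).baseChange (v₀.adicCompletion K)).localTamagawaNumber
      (v₀.adicCompletionIntegers K) ≠ 0)
    [hΦ : IsAddCyclic (((W.baseChange K).baseChange (v₀.adicCompletion K)).toAffine.Point ⧸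
      ((W.baseChange K).baseChange (v₀.adicCompletion K)).goodReductionSubgroup (v₀.adicCompletionIntegers K))]
    (htk : (((W.baseChange K).baseChange (v₀.adicCompletion K)).localTamagawaNumber
      (v₀.adicCompletionIntegers K)).factorization p < k)
    -- a Weil pairing datum on `E[p^k]` over `K`, equivariant under the lift of `τ`
    (e : geomTorsion (W.baseChange K) ((p ^ k : ℕ) : ℤ) →
      geomTorsion (W.baseChange K) ((p ^ k : ℕ) : ℤ) → AlgebraicClosure K)
    (hμ : ∀ S T, e S T ^ (p ^ k) = 1)
    (hadd₁ : ∀ S₁ S₂ T, e (S₁ + S₂) T = e S₁ T * e S₂ T)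
    (hadd₂ : ∀ S T₁ T₂, e S (T₁ + T₂) = e S T₁ * e S T₂)
    (hgal : ∀ (g : absoluteGaloisGroup K) (S T : geomTorsion (W.baseChange K) ((p ^ k : ℕ) : ℤ)),
      g • e S T = e (g • S) (g • T))
    (halt : ∀ T, e T T = 1) (hnondeg : ∀ T, (∀ S, e S T = 1) → T = 0)
    (hτe : ∀ S T, liftAut τ (e S T) =
      e ((isLiftOfAut_liftAut τ).torsionMap W ((p ^ k : ℕ) : ℤ) S)
        ((isLiftOfAut_liftAut τ).torsionMap W ((p ^ k : ℕ) : ℤ) T))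
    -- the transverse family with its reconciliation (e.g. `exists_localTransverseFamily`)
    (𝒯 : SelmerStructure ((W.baseChange K).torsionGaloisModule ((p ^ k : ℕ) : ℤ)))
    (hT : ∀ x : galoisCohomology ((W.baseChange K).torsionGaloisModule ((p ^ k : ℕ) : ℤ)) 1,
      (∀ w ∈ placesDividing K c.1,
        galoisCohomology.localization ((W.baseChange K).torsionGaloisModule ((p ^ k : ℕ) : ℤ))
          (Sum.inr w) 1 x ∈ 𝒯 (Sum.inr w)) ↔
      ∀ ℓ ∈ c.1.primeFactors, x ∈ transverseKer W K ι ((p ^ k : ℕ) : ℤ) ℓ)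
    (h𝒯σ : ∀ (v w : HeightOneSpectrum (𝓞 K)) (h : τ • v = w), v ∈ placesDividing K c.1 →
      ∀ x : galoisCohomology (((W.baseChange K).torsionGaloisModule ((p ^ k : ℕ) : ℤ)).toLocal
        (Sum.inr v : Place K)) 1,
      x ∈ 𝒯 (Sum.inr v) → conjActPlace W τ ((p ^ k : ℕ) : ℤ) h x ∈ 𝒯 (Sum.inr w))
    (h𝒯sd : ∀ inv : LocalInvariants K (p ^ k), inv.IsPerfect → ∀ v ∈ placesDividing K c.1,
      inv.dualTransported 𝒯 (weilDualIntertwining (W.baseChange K) (p ^ k) e hμ hadd₁ hadd₂ hgal)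
        (Sum.inr v) = 𝒯 (Sum.inr v))
    -- LOCAL INPUT: the stringent family is `τ`-stable at the carrier pair
    (h𝒮σ : ∀ (v w : HeightOneSpectrum (𝓞 K)) (h : τ • v = w), v ∈ ({v₀, τ • v₀} : Finset _) →
      ∀ x : galoisCohomology (((W.baseChange K).torsionGaloisModule ((p ^ k : ℕ) : ℤ)).toLocal
        (Sum.inr v : Place K)) 1,
      x ∈ stringentFamily W K hn (Sum.inr v) →
        conjActPlace W τ ((p ^ k : ℕ) : ℤ) h x ∈ stringentFamily W K hn (Sum.inr w))
    -- LOCAL INPUT (Lemma 5.2 (i)–(ii)) at the Kolyvagin primes `λ ∤ c`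
    (hloc : ∀ ℓ : ℕ, Zhang2014.IsKolyvaginPrime (W.conductorNorm ℤ) W K p ℓ →
      k ≤ Zhang2014.kolyvaginIndex W p ℓ → ℓ ∉ c.1.primeFactors →
      ∀ (v : HeightOneSpectrum (𝓞 K)), (ℓ : 𝓞 K) ∈ v.asIdeal → ∀ (hfix : τ • v = v)
        (s : ℤ), s = 1 ∨ s = -1 →
      ((W.baseChange K).kummerSelmerStructure ((p ^ k : ℕ) : ℤ) (Sum.inr v)).relIndex
        ((conjActPlace W τ ((p ^ k : ℕ) : ℤ) hfix - s • AddMonoidHom.id _).ker) = p ^ k)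
    -- KERNEL GAPS (completion layer)
    (htr : ∀ (d : KolyvaginHeegnerData Dt β ι c.1), ∀ ℓ ∈ c.1.primeFactors,
      (d.kolyvaginClass (Fact.out : p.Prime) k :
        galoisCohomology ((W.baseChange K).torsionGaloisModule ((p ^ k : ℕ) : ℤ)) 1) ∈
        transverseKer W K ι ((p ^ k : ℕ) : ℤ) ℓ)
    (h49str : ∀ (ℓ : ℕ), Zhang2014.IsKolyvaginPrime (W.conductorNorm ℤ) W K p ℓ →
      k ≤ Zhang2014.kolyvaginIndex W p ℓ → ℓ ∉ c.1.primeFactors →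
      ∀ (d' : KolyvaginHeegnerData Dt β ι (c.1 * ℓ)), ∀ q ∈ ({v₀, τ • v₀} : Finset _),
      galoisCohomology.localization ((W.baseChange K).torsionGaloisModule ((p ^ k : ℕ) : ℤ))
          (Sum.inr q) 1 (d'.kolyvaginClass (Fact.out : p.Prime) k) ∈ stringentFamily W K hn (Sum.inr q))
    (h49tr : ∀ (ℓ : ℕ), Zhang2014.IsKolyvaginPrime (W.conductorNorm ℤ) W K p ℓ →
      k ≤ Zhang2014.kolyvaginIndex W p ℓ → ℓ ∉ c.1.primeFactors →
      ∀ (d' : KolyvaginHeegnerData Dt β ι (c.1 * ℓ)), ∀ w ∈ placesDividing K c.1,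
      galoisCohomology.localization ((W.baseChange K).torsionGaloisModule ((p ^ k : ℕ) : ℤ))
          (Sum.inr w) 1 (d'.kolyvaginClass (Fact.out : p.Prime) k) ∈ 𝒯 (Sum.inr w)) :
    (((W.baseChange K).baseChange (v₀.adicCompletion K)).localTamagawaNumber
      (v₀.adicCompletionIntegers K)).factorization p ≤ mInf := by
  have hp : p.Prime := Fact.out
  exact tamagawaExponent_le_mInfty_of_localInputs h44 W hcm K hK hD3 hD4 hH hPT p hp2 htower Dt β ι τ
    hτ hτ2 ε hε h53 hcop' hGZ mdiv m hmdiv hm k c hk hcore mInf hmc hkM _ htk hik e hμ hadd₁ hadd₂ hgal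
    halt hnondeg hτe 𝒯 hT h𝒯σ h𝒯sd (stringentFamily W K hn) (stringentFamily_le_kummer W K hn) v₀ hv₀
    hv₀N h𝒮σ (isAddCyclic_kummer_quotient_stringentFamily W K hn v₀)
    (relIndex_stringentFamily_eq_pow W K hp k hn v₀ hc0 htk.le) hloc htr h49str h49tr

end Summit.BirchSwinnertonDyer.Rank1Residual.JET

end
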